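import Summits.AtomisticToContinuum.Crystallization.Theorems.PeriodCoherenceLadderCleanWindows

/-!
# Route `PeriodCoherenceLadder`, residual crux `MesoscopicCoarsePeriods`: the TRANSFER «costs ⇒ sparse bad balls», part 1 (counting and clear windows)

Third reduction file of the line beneath the residual crux (after `…CleanRegions`, `…CleanWindows`).  It proves
the finite-`N`-to-hull transfer of the skeleton «frustration is paid for»: if

* (FSC, the new Lennard-Jones inequality, kept as a HYPOTHESIS) for every clearance `r₀ > 0` there are constants
  `0 < δ ≤ 7/10`, `b`, `κ > 0`, `C` with `κ · #{frustrated particles} ≤ (E(N) − N·e*) + C · #{r₀-exposed particles}`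
  in every `N`-particle ground state — a particle is *frustrated* when the ball of radius `4b + 2r₀ + 3` around it
  carries no local coarse period `t` (`δ ≤ ‖t‖ ≤ b`, precision `δ/4`, two-sided), *exposed* when a hole of
  clearance `r₀` lies within `4b + 2r₀ + 4` of it;
* (ESC = `SurfaceTensionNoFoam.ExposedSitesCost`, existing crux stmt-AtomisticToContinuum-13448, HYPOTHESIS, text
  verbatim) exposed particles cost energy;
* (CEL = `SurfaceTensionNoFoam.CrysEnergyLimit`, PROVED in the tree — `CrysEnergyLimit_holds`; hypothesis here only
  to keep this file inside the route's own import cone) `E(N)/N → e*`;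
* (SEP = uniform separation `7/10`, LANDED — `Theorems.LjLaminarWindowsSketch.lennardJones_groundState_dist_ge_seven_tenths`;
  hypothesis here for the same reason);

then along any sequence of ground states some Delone hull point has NO bad ball at all — in particular the
sparse-bad-balls hypothesis of `…CleanWindows.cleanWindows_of_sparse` holds, and with the two landed reductions the
crux `MesoscopicCoarsePeriods` follows (`mesoscopicCoarsePeriods_of_costs`).

Proof: counting (frustrated + exposed particles are `≤ K · (E(N) − N e*) = o(N)`; a `7/10`-separated set has at
most `m(ρ)` points in a ball of radius `ρ`, by a finite cover with balls of radius `7/20`), so for every `k` and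
all large `N` some particle has no bad particle within `k + r₀`; re-centred windows; local-matching compactness
(`PeriodPrecisionLadderExactPeriodFromFine.exists_subseq_forall_eventually_match`); density of the limit from the
absence of exposed particles (intermediate value theorem for the clearance along a segment); local coarse periods of
the limit from the non-frustrated particles (Bolzano–Weierstrass for the periods, attained infimum `δ/4`).
-/

noncomputable section

namespace Summit.AtomisticToContinuum.Crystallization.Theorems

namespace PeriodCoherenceLadderSparseTransfer

open Literature.MathematicalPhysics.StatisticalMechanics
open Filter Topology Metric
open Summit.AtomisticToContinuum.Crystallization.Theorems.PeriodPrecisionLadderExactPeriodFromFine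

/-- Packing bound: a `7/10`-separated finite set inside a ball of radius `ρ` has boundedly many points. -/
theorem exists_card_le_of_separated (ρ : ℝ) : ∃ m : ℕ,
    ∀ (S : Finset (EuclideanSpace ℝ (Fin 3))) (c : EuclideanSpace ℝ (Fin 3)),
      (∀ p ∈ S, ∀ q ∈ S, p ≠ q → (7 : ℝ) / 10 ≤ dist p q) → (∀ p ∈ S, dist p c ≤ ρ) → S.card ≤ m := by
  obtain ⟨T, -, hTfin, hcover⟩ := finite_cover_balls_of_compact
    (isCompact_closedBall (0 : EuclideanSpace ℝ (Fin 3)) ρ) (show (0 : ℝ) < 7 / 20 by norm_num)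
  refine ⟨hTfin.toFinset.card, fun S c hsep hS => ?_⟩
  have hmem : ∀ p ∈ S, ∃ τ ∈ hTfin.toFinset, dist (p - c) τ < 7 / 20 := by
    intro p hp
    have h1 : p - c ∈ closedBall (0 : EuclideanSpace ℝ (Fin 3)) ρ := by
      rw [mem_closedBall, dist_zero_right, ← dist_eq_norm]; exact hS p hp
    obtain ⟨τ, hτ, hpτ⟩ := Set.mem_iUnion₂.1 (hcover h1)
    exact ⟨τ, hTfin.mem_toFinset.2 hτ, mem_ball.1 hpτ⟩
  choose! g hg hdg using hmem
  refine Finset.card_le_card_of_injOn g (fun p hp => hg p hp) ?_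
  intro p hp q hq hpq
  by_contra hne
  have h1 := hsep p hp q hq hne
  have h2 : dist (p - c) (q - c) < 7 / 10 := by
    calc dist (p - c) (q - c) ≤ dist (p - c) (g p) + dist (q - c) (g p) := dist_triangle_right _ _ _
      _ < 7 / 20 + 7 / 20 := add_lt_add (hdg p hp) (by rw [hpq]; exact hdg q hq)
      _ = 7 / 10 := by norm_num
  rw [dist_sub_right] at h2
  linarith

/-- From `E(N)/N → e*`: the excess `E(N) − N e*` is `o(N)`. -/
theorem tendsto_excess_div (e : ℝ) (f : ℕ → ℝ)
    (h : Tendsto (fun N : ℕ => f N / N) atTop (nhds e)) :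
    Tendsto (fun N : ℕ => (f N - (N : ℝ) * e) / N) atTop (nhds 0) := by
  have h1 : Tendsto (fun N : ℕ => f N / N - e) atTop (nhds (e - e)) := h.sub_const e
  rw [sub_self] at h1
  refine h1.congr' ?_
  filter_upwards [eventually_ge_atTop 1] with N hN
  have hN : (N : ℝ) ≠ 0 := by positivity
  field_simp


/-- **Clear windows.**  Under the two cost inequalities and `a N = o(N)`: for every `k`, in every large
ground state some particle has neither a frustrated nor an exposed particle within distance `k + r₀`
(counting: bad particles are `≤ K · a N`; fibres of «a bad particle near z» are `7/10`-separated sets in a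
ball of radius `k + r₀`, bounded by the packing lemma). -/
theorem exists_clear_window (x : (N : ℕ) → (Fin N → EuclideanSpace ℝ (Fin 3)))
    (hsep : ∀ (N : ℕ) (i j : Fin N), i ≠ j → (7 : ℝ) / 10 ≤ dist (x N i) (x N j))
    (a : ℕ → ℝ) (hlim : Tendsto (fun N : ℕ => a N / N) atTop (nhds 0))
    (r₀ δ b κ C c₀ R' : ℝ) (hδ : 0 < δ) (hδ7 : δ ≤ 7 / 10) (hκ : 0 < κ) (hc₀ : 0 < c₀)
    (hR'1 : 4 * b + 2 * r₀ + 4 ≤ R')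
    (hF : ∀ N : ℕ, κ * (Nat.card {i : Fin N // ¬ ∃ t : EuclideanSpace ℝ (Fin 3), δ ≤ ‖t‖ ∧ ‖t‖ ≤ b ∧ ∀ j : Fin N, dist (x N j) (x N i) ≤ 4 * b + 2 * r₀ + 3 → (∃ k : Fin N, dist (x N j + t) (x N k) ≤ δ / 4) ∧ (∃ k : Fin N, dist (x N j - t) (x N k) ≤ δ / 4)} : ℝ) ≤ a N + C * (Nat.card {i : Fin N // ∃ p : EuclideanSpace ℝ (Fin 3), dist p (x N i) ≤ 4 * b + 2 * r₀ + 4 ∧ ∀ j : Fin N, r₀ ≤ dist p (x N j)} : ℝ))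
    (hE : ∀ N : ℕ, c₀ * (Nat.card {i : Fin N // ∃ p : EuclideanSpace ℝ (Fin 3), dist p (x N i) ≤ R' ∧ ∀ j : Fin N, r₀ ≤ dist p (x N j)} : ℝ) ≤ a N) :
    ∀ k : ℕ, ∃ n : ℕ, ∀ N : ℕ, n ≤ N →
      ∃ z : Fin N, ∀ i : Fin N, dist (x N i) (x N z) ≤ (k : ℝ) + r₀ → ¬ ((¬ ∃ t : EuclideanSpace ℝ (Fin 3), δ ≤ ‖t‖ ∧ ‖t‖ ≤ b ∧ ∀ j : Fin N, dist (x N j) (x N i) ≤ 4 * b + 2 * r₀ + 3 → (∃ k : Fin N, dist (x N j + t) (x N k) ≤ δ / 4) ∧ (∃ k : Fin N, dist (x N j - t) (x N k) ≤ δ / 4)) ∨ (∃ p : EuclideanSpace ℝ (Fin 3), dist p (x N i) ≤ R' ∧ ∀ j : Fin N, r₀ ≤ dist p (x N j))) := by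
  classical
  have hinj : ∀ N, Function.Injective (x N) := fun N i j hij => by
    by_contra hne
    have h1 := hsep N i j hne
    rw [hij, dist_self] at h1
    linarith
  -- names for the three particle predicates
  set FR : (N : ℕ) → Fin N → Prop := fun N i => ¬ ∃ t : EuclideanSpace ℝ (Fin 3), δ ≤ ‖t‖ ∧ ‖t‖ ≤ b ∧ ∀ j : Fin N, dist (x N j) (x N i) ≤ 4 * b + 2 * r₀ + 3 → (∃ k : Fin N, dist (x N j + t) (x N k) ≤ δ / 4) ∧ (∃ k : Fin N, dist (x N j - t) (x N k) ≤ δ / 4) with hFR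
  set EX : (N : ℕ) → Fin N → Prop := fun N i => ∃ p : EuclideanSpace ℝ (Fin 3), dist p (x N i) ≤ 4 * b + 2 * r₀ + 4 ∧ ∀ j : Fin N, r₀ ≤ dist p (x N j) with hEX
  set EX' : (N : ℕ) → Fin N → Prop := fun N i => ∃ p : EuclideanSpace ℝ (Fin 3), dist p (x N i) ≤ R' ∧ ∀ j : Fin N, r₀ ≤ dist p (x N j) with hEX'
  -- Step 0: counting — bad particles are `≤ K · a N`
  have ha0 : ∀ N, 0 ≤ a N := fun N =>
    le_trans (mul_nonneg hc₀.le (Nat.cast_nonneg _)) (hE N)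
  set K : ℝ := (1 + max C 0 / c₀) / κ + 1 / c₀ with hK
  have hK0 : 0 ≤ K := by positivity
  have hbad : ∀ N, ((Finset.univ.filter fun i : Fin N => FR N i ∨ EX' N i).card : ℝ) ≤ K * a N := by
    intro N
    have h1 := hF N
    have h2 := hE N
    simp only [Nat.card_eq_fintype_card, Fintype.card_subtype] at h1 h2
    -- #EX ≤ #EX'
    have h3 : ((Finset.univ.filter fun i : Fin N => EX N i).card : ℝ) ≤
        (Finset.univ.filter fun i : Fin N => EX' N i).card := by
      exact_mod_cast Finset.card_le_card (Finset.monotone_filter_right _ fun i _ hi => by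
        obtain ⟨p, hp1, hp2⟩ := hi; exact ⟨p, hp1.trans hR'1, hp2⟩)
    have hEX'le : ((Finset.univ.filter fun i : Fin N => EX' N i).card : ℝ) ≤ a N / c₀ := by
      rw [le_div_iff₀ hc₀]; linarith
    have h4 : C * ((Finset.univ.filter fun i : Fin N => EX N i).card : ℝ) ≤ max C 0 * (a N / c₀) := by
      calc C * ((Finset.univ.filter fun i : Fin N => EX N i).card : ℝ)
          ≤ max C 0 * ((Finset.univ.filter fun i : Fin N => EX N i).card : ℝ) :=
            mul_le_mul_of_nonneg_right (le_max_left _ _) (Nat.cast_nonneg _)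
        _ ≤ max C 0 * (a N / c₀) := mul_le_mul_of_nonneg_left (h3.trans hEX'le) (le_max_right _ _)
    have hFRle : ((Finset.univ.filter fun i : Fin N => FR N i).card : ℝ) ≤ (a N + max C 0 * (a N / c₀)) / κ := by
      rw [le_div_iff₀ hκ]; linarith
    have h5 : ((Finset.univ.filter fun i : Fin N => FR N i ∨ EX' N i).card : ℝ) ≤
        ((Finset.univ.filter fun i : Fin N => FR N i).card : ℝ) + (Finset.univ.filter fun i : Fin N => EX' N i).card := by
      rw [Finset.filter_or]
      exact_mod_cast Finset.card_union_le _ _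
    calc ((Finset.univ.filter fun i : Fin N => FR N i ∨ EX' N i).card : ℝ)
        ≤ (a N + max C 0 * (a N / c₀)) / κ + a N / c₀ := h5.trans (add_le_add hFRle hEX'le)
      _ = K * a N := by rw [hK]; ring
  -- Step 1: windows — for every k, for all large N some particle has no bad particle within k + r₀
  intro k
  obtain ⟨m, hm⟩ := exists_card_le_of_separated ((k : ℝ) + r₀)
  have hpos : (0 : ℝ) < 1 / ((m : ℝ) * K + 1) := by positivity
  have ev1 : ∀ᶠ N : ℕ in atTop, a N / N < 1 / ((m : ℝ) * K + 1) :=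
    (Metric.tendsto_nhds.1 hlim _ hpos).mono fun N hN => by
      rw [Real.dist_eq, sub_zero] at hN; exact lt_of_abs_lt hN
  obtain ⟨n, hn⟩ := (ev1.and (eventually_ge_atTop 1)).exists_forall_of_atTop
  refine ⟨n, fun N hN => ?_⟩
  obtain ⟨hsmall, hN1⟩ := hn N hN
  change ∃ z : Fin N, ∀ i : Fin N, dist (x N i) (x N z) ≤ (k : ℝ) + r₀ → ¬ (FR N i ∨ EX' N i)
  by_contra hcon
  push Not at hcon
  choose f hfd hfb using hcon
  -- fibres of `f` are `7/10`-separated sets in a ball of radius k + r₀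
  have hfib : ∀ i ∈ (Finset.univ : Finset (Fin N)).image f,
      ((Finset.univ : Finset (Fin N)).filter fun z => f z = i).card ≤ m := by
    intro i _
    have hcard : (((Finset.univ : Finset (Fin N)).filter fun z => f z = i).image (x N)).card =
        ((Finset.univ : Finset (Fin N)).filter fun z => f z = i).card :=
      Finset.card_image_of_injective _ (hinj N)
    rw [← hcard]
    refine hm _ (x N i) ?_ ?_
    · intro p hp q hq hpq
      rw [Finset.mem_image] at hp hq
      obtain ⟨z₁, -, rfl⟩ := hp
      obtain ⟨z₂, -, rfl⟩ := hq
      exact hsep N z₁ z₂ fun h => hpq (by rw [h])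
    · intro p hp
      rw [Finset.mem_image] at hp
      obtain ⟨z₁, hz₁, rfl⟩ := hp
      rw [Finset.mem_filter] at hz₁
      have := hfd z₁
      rw [hz₁.2] at this
      rwa [dist_comm] at this
  have hle : (Finset.univ : Finset (Fin N)).card ≤ m * ((Finset.univ : Finset (Fin N)).image f).card :=
    Finset.card_le_mul_card_image _ m hfib
  have himg : ((Finset.univ : Finset (Fin N)).image f).card ≤
      (Finset.univ.filter fun i : Fin N => FR N i ∨ EX' N i).card := by
    refine Finset.card_le_card ?_
    intro i hi
    rw [Finset.mem_image] at hi
    obtain ⟨z₁, -, rfl⟩ := hi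
    rw [Finset.mem_filter]
    exact ⟨Finset.mem_univ _, hfb z₁⟩
  have hN : ((N : ℕ) : ℝ) ≤ (m : ℝ) * (K * a N) := by
    have h1 : ((Finset.univ : Finset (Fin N)).card : ℝ) ≤ (m : ℝ) * ((Finset.univ.filter fun i : Fin N => FR N i ∨ EX' N i).card : ℝ) := by
      exact_mod_cast hle.trans (Nat.mul_le_mul_left m himg)
    rw [Finset.card_univ, Fintype.card_fin] at h1
    exact h1.trans (mul_le_mul_of_nonneg_left (hbad N) (Nat.cast_nonneg _))
  have hN1' : (1 : ℝ) ≤ N := by exact_mod_cast hN1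
  have hNpos : (0 : ℝ) < N := by linarith
  rw [div_lt_div_iff₀ hNpos (by positivity), one_mul] at hsmall
  -- a N * (m K + 1) < N ≤ m K a N ≤ (m K + 1) a N : contradiction
  nlinarith [ha0 N, hK0, (Nat.cast_nonneg m : (0:ℝ) ≤ m)]

end PeriodCoherenceLadderSparseTransfer

end Summit.AtomisticToContinuum.Crystallization.Theorems

end
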